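/-
Copyright (c) 2026 the pub-hodgecm2 formalisation cell (harness21).  New file, not vendored.
Origin: (c-S.1) RE-KEY error wave, pair «subcorner» seat «a» (prover-pub-hodgecm2-rekey-l1-subcorner-a-g0-0), 2026-08-23.
COMPANION of seat «b»'s helper `Rekey/Binders/LiftTypeConj.lean` ((S1) `liftType_starRingEnd_comp`, (S1′) `liftType_conjRingHomK_comp`, (S2) the
joint flip of the supply guard): here the CONSUMER side — the (J4a) identification CLAUSE of the junction read at `ῑ₁` as an `∃ j`-statement, and what
it means at TODAY's served contexts (`SignRecipe.GoodCtx (orientBitι L ι₁) ι₁ c`): it holds at the SAME corner `(c.K, c.Ψ i, c.σ)` for the MIRROR line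
`Φ^δ(−a_i)`, where `PhiMu′` also holds.  KERNEL ONLY: theorems; no definition, nothing cited anew.  HC_CM is NOT proved here or by this.
-/
import Summits.HodgeConjecture.CorCM.Rekey.Binders.LiftTypeConj
import Summits.HodgeConjecture.HodgeCM.Model.Binders.JLiuSubCornerAdm
import Summits.HodgeConjecture.HodgeCM.Model.Binders.JLiuLineType
import Summits.HodgeConjecture.CorCM.D2Bridge.ReflexOfTypeConj
import HarnessLib

set_option autoImplicit false

/-!
Re-key (c-S.1) consumer-side seam lemmas for the (J4a) clause — HELD; HC_CM is NOT proved.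

# The (J4a) clause read at `ῑ₁` = the clause at `ι₁` for the conjugate type; the mirror line serves the same corner

Notation: `ῑ₁ := (starRingEnd ℂ).comp ι₁`, `c_L := conjRingHomK L`, `Φ̄ := CMTypeOps.bar Φ`, `Φ^δ(a) := SignRecipe.lineType a _ _`.

* `liftTyped_starRingEnd_comp_iff` — **`(∃ j, ῑ₁ ∘ j = σ ∧ Φ = liftType h K L j ῑ₁ Ψ) ↔ (∃ j, ι₁ ∘ j = σ ∧ Φ̄ = liftType h K L j ι₁ Ψ)`**
  (witnesses `j ↦ c_L ∘ j` both ways; seat «b»'s (S1) + (S1′)).  With K1 (`isReflexOfTypeG_conj_iff : d.IsReflexOfTypeG ῑ₁ Φ ↔ d.IsReflexOfTypeG ι₁ Φ̄`,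
  ✔ p371989) this says: the primed junction hypotheses (`adm′`, (J4a) at `ῑ₁`) at a line of type `Φ` for the corner `(K, Ψ, σ)` are LITERALLY the
  unprimed ones for `Φ̄ = Φ_{μ^c}` at the SAME corner — the primed socket `Rekey.isSubCorner_of_liftTyped` ∕ `Rekey.subset_Uiso_of_block_of_liftTyped`
  is the live one at `Φ̄` (`isSubCorner_of_adm'_of_liftTyped_bar`).
* `bar_lineType` — `bar Φ^δ(a) = Φ^δ(−a)`.
* `liftTyped_starRingEnd_comp_lineType_neg`, `starRingEnd_comp_mem_lineType_neg` — at every good context OF THE BIT OF RECORD (`L/ℚ` Galois) the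
  primed (J4a) clause HOLDS at the same corner for the mirror line `Φ^δ(−a_i)` (binder-2 `GoodCtx.liftTyped_lineType`: `Φ^δ(a_i) = liftType false c.K L j ι₁ (c.Ψ i)`),
  and `PhiMu′ = (ῑ₁ ∈ ·)` holds at `Φ^δ(−a_i)` and fails at `Φ^δ(a_i)`.

Consequence for the junction re-read (`Rekey/HThetaJunctionR2BGal` §2, the «N∕W fork»; prose only): besides seat «b»'s route (serve the context over
`ῑ₁`: `GoodCtx (orientBitι L ῑ₁) ῑ₁ c`, excluded at the same `c` by `GoodCtx.not_jointFlip`), there is a CONSUMER-SIDE route that keeps today's supply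
guard `GoodCtx (orientBitι L ι₁) ι₁ c` and the corner `(c.K, c.Ψ i, c.σ)` verbatim and changes ONLY the slot clause of
`hsmall_of_tower_at_block_of_lineType_eq_gal′` to `Φ^δ(scalar μ) = Φ^δ(−a_i)`: then clause 1 (`PhiMu′`), clause 2 (sub-corner, via `adm′ = adm` at
`Φ^δ(a_i)`) and #H14's `hσ : c.σ ∈ c.Ψ i` all hold, and the ONE remaining obligation is on the theta side — the slot-`i` theta classes must lie in the
block of the MIRROR line (`scalar = −a_i` up to norms) instead of `lineRepOf i` (`HThetaBlockSlots01∕23.hJ_slot_*_block_of_lineRepOf`).  Which of the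
two routes the theta supply can honour is the LAYER-2∕3 question (own-htheta), not settled here.

KIND: kernel, 0 proof holes; expected `#print axioms` ⊆ {propext, Classical.choice, Quot.sound}.
-/

noncomputable section

open NumberField NumberField.ComplexEmbedding
open scoped ComplexConjugate
open Literature.AlgebraicGeometry.Motives (CMType)
open Literature.AlgebraicGeometry.ShimuraVarieties (conjRingHomK embedding_conjRingHomK)
open HodgeCM HodgeCM.SignRecipe
open HodgeCM.CMTypeOps (bar mem_bar_iff conjugate_mem_iff_notMem bar_bar)

namespace HodgeCM.Model.Rekey

variable {K L : CMField}

/-- `ι₁ ∘ (c_L ∘ j) = ῑ₁ ∘ j`: conjugating the guard embedding on the `L` side conjugates the corner embedding. [folklore] -/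
theorem comp_conjRingHomK_comp (ι₁ : (L : Type) →+* ℂ) (j : (K : Type) →+* L) :
    ι₁.comp ((conjRingHomK L).comp j) = ((starRingEnd ℂ).comp ι₁).comp j := by
  ext x
  rw [RingHom.comp_apply, RingHom.comp_apply, RingHom.comp_apply, RingHom.comp_apply, embedding_conjRingHomK]

/-- **THE (J4a) CLAUSE UNDER THE RE-KEY.**  For a corner `(K, Ψ, σ)`, a bit `h` and a type `Φ` of `L`:
`(∃ j, ῑ₁ ∘ j = σ ∧ Φ = liftType h K L j ῑ₁ Ψ) ↔ (∃ j, ι₁ ∘ j = σ ∧ Φ̄ = liftType h K L j ι₁ Ψ)` — the identification READ AT the conjugate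
presentation embedding is the identification at `ι₁` for the CONJUGATE type (witnesses `j ↦ c_L ∘ j` both ways; (S1) `liftType_starRingEnd_comp` +
(S1′) `liftType_conjRingHomK_comp`). [folklore] -/
theorem liftTyped_starRingEnd_comp_iff (h : Bool) (ι₁ : (L : Type) →+* ℂ) (σ : (K : Type) →+* ℂ) (Ψ : CMType K) (Φ : CMType L) :
    (∃ j : (K : Type) →+* L, ((starRingEnd ℂ).comp ι₁).comp j = σ ∧ Φ = liftType h K L j ((starRingEnd ℂ).comp ι₁) Ψ) ↔
      (∃ j : (K : Type) →+* L, ι₁.comp j = σ ∧ bar Φ = liftType h K L j ι₁ Ψ) := by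
  constructor
  · rintro ⟨j, hj, hΦ⟩
    refine ⟨(conjRingHomK L).comp j, by rw [comp_conjRingHomK_comp, hj], ?_⟩
    rw [liftType_conjRingHomK_comp, hΦ, liftType_starRingEnd_comp]
  · rintro ⟨j, hj, hΦ⟩
    refine ⟨(conjRingHomK L).comp j, by rw [starRingEnd_comp_comp_conjRingHomK_comp, hj], ?_⟩
    rw [liftType_starRingEnd_comp, liftType_conjRingHomK_comp, ← hΦ, bar_bar]

/-- **Clause 2 at `ῑ₁` from the UNPRIMED data at `Φ̄`**: a record admissible AT `ῑ₁` for `Φ` (the primed `adm′`) is a sub-corner of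
`(c.K, c.Ψ i, c.σ)` as soon as the CONJUGATE type `Φ̄` carries the (J4a) identification at `ι₁` there (K1 + the live `isSubCorner_of_eq`);
by `liftTyped_starRingEnd_comp_iff` this is the primed twin `Rekey.isSubCorner_of_liftTyped` with its hypothesis rewritten. [folklore] -/
theorem isSubCorner_of_adm'_of_liftTyped_bar {ι₁ : (L : Type) →+* ℂ} [IsGalois ℚ L] {c : SeesawCtx L} {i : Fin 4} {Φ : CMType L}
    (hΦ : ∃ j : (c.K : Type) →+* L, ι₁.comp j = c.σ ∧ bar Φ = liftType false c.K L j ι₁ (c.Ψ i))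
    (d : HodgeCM.Model.LiuCMSide) (hd : d.IsReflexOfTypeG ((starRingEnd ℂ).comp ι₁) Φ) : d.IsSubCorner c.K (c.Ψ i) c.σ :=
  HodgeCM.Model.LiuCMSide.isSubCorner_of_eq (ι₁ := ι₁) hΦ.choose_spec.1 (c.Ψ i) hΦ.choose_spec.2 d
    ((Summit.HodgeConjecture.CorCM.D2Bridge.isReflexOfTypeG_conj_iff ι₁ d Φ).1 hd)

/-! ## At a good context of the bit of record: the mirror line `Φ^δ(−a_i)` serves the same corner -/

/-- `bar Φ^δ(a) = Φ^δ(−a)`: the conjugate of the line type of a real scalar is the line type of its negative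
(`Φ^δ(a) = {τ ∣ 0 < Im τ(η_L a)}` and `Im τ(η_L a) ≠ 0`). [folklore] -/
theorem bar_lineType (a : L) (ha : conjRingHomK L a = a) (ha0 : a ≠ 0) :
    bar (lineType a ha ha0) = lineType (-a) (by rw [map_neg, ha]) (neg_ne_zero.mpr ha0) := by
  apply Subtype.ext
  ext τ
  show ¬ 0 < (τ (eta L * a)).im ↔ 0 < (τ (eta L * -a)).im
  have hne : (τ (eta L * a)).im ≠ 0 := by
    rw [im_embedding_eta_mul]
    exact mul_ne_zero (embedding_eta_im_ne_zero L τ) (re_embedding_ne_zero_of_conj_eq ha ha0 τ)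
  rw [mul_neg, map_neg, Complex.neg_im, neg_pos, not_lt]
  exact ⟨fun h => lt_of_le_of_ne h hne, le_of_lt⟩

/-- **At every good context of the bit of record (`L/ℚ` Galois) the (J4a) clause READ AT `ῑ₁` holds at the corner `(c.K, c.Ψ i, c.σ)` for the
MIRROR line type `Φ^δ(−a_i)`** (`liftTyped_starRingEnd_comp_iff` + `bar_lineType` + binder-2 `GoodCtx.liftTyped_lineType`). [folklore] -/
theorem liftTyped_starRingEnd_comp_lineType_neg [IsGalois ℚ L] {ι₁ : (L : Type) →+* ℂ} {c : SeesawCtx L}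
    (hc : GoodCtx (Model.orientBitι L ι₁) ι₁ c) (i : Fin 4) :
    ∃ j : (c.K : Type) →+* L, ((starRingEnd ℂ).comp ι₁).comp j = c.σ ∧
      lineType (-c.D.a i) (by rw [map_neg, c.D.a_real i]) (neg_ne_zero.mpr (c.D.a_ne i)) =
        liftType false c.K L j ((starRingEnd ℂ).comp ι₁) (c.Ψ i) := by
  rw [liftTyped_starRingEnd_comp_iff]
  obtain ⟨j, hj, hji⟩ := GoodCtx.liftTyped_lineType hc i
  refine ⟨j, hj, ?_⟩
  rw [← hji, bar_lineType]
  exact lineType_congr (neg_neg _) _ _ _ _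

/-- … and `PhiMu′` HOLDS at the mirror line (`ῑ₁ ∈ Φ^δ(−a_i)`, from `ι₁ ∈ Φ^δ(a_i)` = `GoodCtx.self_mem_lineType`) while it FAILS at the served
line (`ῑ₁ ∉ Φ^δ(a_i)`). [folklore] -/
theorem starRingEnd_comp_mem_lineType_neg {ι₁ : (L : Type) →+* ℂ} {c : SeesawCtx L}
    (hc : GoodCtx (Model.orientBitι L ι₁) ι₁ c) (i : Fin 4) :
    (starRingEnd ℂ).comp ι₁ ∈ (lineType (-c.D.a i) (by rw [map_neg, c.D.a_real i]) (neg_ne_zero.mpr (c.D.a_ne i))).1 ∧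
      (starRingEnd ℂ).comp ι₁ ∉ (lineType (c.D.a i) (c.D.a_real i) (c.D.a_ne i)).1 := by
  have e : (starRingEnd ℂ).comp ι₁ = conjugate ι₁ := RingHom.ext fun _ => rfl
  have hι : ι₁ ∈ (lineType (c.D.a i) (c.D.a_real i) (c.D.a_ne i)).1 := GoodCtx.self_mem_lineType hc i
  have hbar : conjugate ι₁ ∉ (lineType (c.D.a i) (c.D.a_real i) (c.D.a_ne i)).1 :=
    (CMTypeOps.mem_iff_conjugate_notMem _ ι₁).mp hι
  refine ⟨?_, by rw [e]; exact hbar⟩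
  rw [e, ← bar_lineType, mem_bar_iff]
  exact hbar

/-- **The mirror line's `adm′` IS the served line's `adm`**: admissibility at `ῑ₁` for `Φ^δ(−a)` is admissibility at `ι₁` for `Φ^δ(a)` (K1 + `bar_lineType`
+ `bar_bar`) — so under `h418′` the mirror line carries the SAME CM classes the unprimed dictionary attaches to the served line. [folklore] -/
theorem isReflexOfTypeG_starRingEnd_comp_lineType_neg_iff (ι₁ : (L : Type) →+* ℂ) (d : HodgeCM.Model.LiuCMSide)
    (a : L) (ha : conjRingHomK L a = a) (ha0 : a ≠ 0) :
    d.IsReflexOfTypeG ((starRingEnd ℂ).comp ι₁) (lineType (-a) (by rw [map_neg, ha]) (neg_ne_zero.mpr ha0)) ↔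
      d.IsReflexOfTypeG ι₁ (lineType a ha ha0) := by
  rw [Summit.HodgeConjecture.CorCM.D2Bridge.isReflexOfTypeG_conj_iff, ← bar_lineType, bar_bar]

end HodgeCM.Model.Rekey

end
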